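import Mathlib
import Summits.ValiantsHypothesis.ValiantsHypothesis.Theorems.GeneratorObstructionsPowGenDegreeQPDixonParity

/-!
# Route GeneratorObstructions — crux K2 `PowGenDegreeQP` (stmt-ValiantsHypothesis-11655), line
# `trace-side-regimes`: the block signed count of the tableau certificate (design `D*`)

Companion of `…PowGenDegreeQPDixonParity` / `…TableauBridge` (blueprint: evidence memo
`evidence-11655-leafhand3-g5.md` on the item).  The value at the canonical doubling gadget of the
blueprint's tableau highest-weight vector factorises over the gadget blocks into copies of ONE signed
count, that of the 3-label block design `D*`:

* rows `0 = A'`, `1 = A`, `2 = B` (top-down order of the block's letters inside a column); labels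
  `0, 1, 2`; `3k` TRIPLE columns `i` carrying the labels `dstarTripleLab k i : Perm (Fin 3)` (row ↦
  label: `(1,2,0)` for `i < k`, `(0,2,1)` for `k ≤ i < 2k`, `(0,1,2)` for `2k ≤ i`) and `3k` PAIR columns
  carrying `dstarPairLab k i : Fin 2 → Fin 3` on rows `(A', A)` (`(1,0)`, `(2,0)`, `(2,1)`);
* a configuration is `σ : Fin 3k → Perm (Fin 3)`, `τ : Fin 3k → Perm (Fin 2)` (the box in row `r` of
  column `i` receives the LETTER of row `σ_i r`, as in `TableauEval.TabM.word`); its exponent vector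
  `blockExpo` counts, for each (label, letter), the boxes of that label receiving that letter; it is
  VALID iff `blockExpo = blockTgt` (every label: `2k` letters `A'`, `2k` letters `A`, `k` letters `B` —
  the gadget monomial `x_B^k x_A^{2k} x_{A'}^{2k}`);
* `blockSum k = Σ_{valid (σ,τ)} ∏ sign σ_i ∏ sign τ_i`.

Results:
* `coeff_blockGen` — generating identity: `blockSum k` is the coefficient of `blockTgt k` in
  `∏_i tripleGen_i · ∏_i pairGen_i`, and `blockGen_eq`: that product is `D^{3k} (Δ₀₁ Δ₀₂ Δ₁₂)^k`,
  `D = det (x_{ℓ,r})`, `Δ_{pq} = x_{p,A'} x_{q,A} - x_{p,A} x_{q,A'}`;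
* (companion file `…PowGenDegreeQPBlockCountEval`: `blockSum k = (-1)^k · C(3k,k) C(2k,k) · E(k)`,
  `E(k)` the Dixon sum, and `blockSum (2^t) ≠ 0`).

Honest framing: a finite combinatorial identity serving the explicit-HWV certificate for the
conditional refutation of K2 (`not_powGenDegreeQP_of_canonicalGadgetGIT_pow`); no stub, crux or summit
is settled here; `VP ≠ VNP` untouched. [folklore]
-/

namespace Summit.ValiantsHypothesis.ValiantsHypothesis.Theorems.GeneratorObstructions.PowGenDegreeQP

-- `Summit.ValiantsHypothesis.ValiantsHypothesis.…` is the tree's mandated single-conjunct layout.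
set_option linter.dupNamespace false

open MvPolynomial Finset

noncomputable section

/-! ## §1 The design `D*` and the signed count -/

/-- Labels (row ↦ label) of the `i`-th triple column of `D*` (rows `0 = A'`, `1 = A`, `2 = B`):
`(1,2,0)` for `i < k`, `(0,2,1)` for `k ≤ i < 2k`, `(0,1,2)` for `2k ≤ i`. [folklore] -/
def dstarTripleLab (k : ℕ) (i : Fin (3 * k)) : Equiv.Perm (Fin 3) :=
  if i.val < k then finRotate 3 else if i.val < 2 * k then Equiv.swap 1 2 else 1

/-- Labels of the `i`-th pair column of `D*` on rows `(A', A)`: `(1,0)`, `(2,0)`, `(2,1)`. [folklore] -/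
def dstarPairLab (k : ℕ) (i : Fin (3 * k)) : Fin 2 → Fin 3 :=
  if i.val < k then ![1, 0] else if i.val < 2 * k then ![2, 0] else ![2, 1]

/-- The exponent vector of a configuration: for each (label, letter) the number of boxes of that
label receiving that letter (pair columns only carry the letters `A' = 0`, `A = 1`). [folklore] -/
def blockExpo (k : ℕ) (σ : Fin (3 * k) → Equiv.Perm (Fin 3)) (τ : Fin (3 * k) → Equiv.Perm (Fin 2)) :
    (Fin 3 × Fin 3) →₀ ℕ :=
  (∑ i, ∑ r : Fin 3, Finsupp.single (dstarTripleLab k i r, σ i r) 1) +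
    ∑ i, ∑ r : Fin 2, Finsupp.single (dstarPairLab k i r, Fin.castSucc (τ i r)) 1

/-- The target exponent vector: every label gets `2k` letters `A'`, `2k` letters `A`, `k` letters `B`.
[folklore] -/
def blockTgt (k : ℕ) : (Fin 3 × Fin 3) →₀ ℕ :=
  ∑ ℓ : Fin 3, (Finsupp.single (ℓ, 0) (2 * k) + Finsupp.single (ℓ, 1) (2 * k) + Finsupp.single (ℓ, 2) k)

/-- **The block signed count** of the design `D*`: the sum over valid configurations of the
product of the signs of the column permutations. [folklore] -/
def blockSum (k : ℕ) : ℤ :=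
  ∑ σ : Fin (3 * k) → Equiv.Perm (Fin 3), ∑ τ : Fin (3 * k) → Equiv.Perm (Fin 2),
    if blockExpo k σ τ = blockTgt k then
      (∏ i, (Equiv.Perm.sign (σ i) : ℤ)) * ∏ i, (Equiv.Perm.sign (τ i) : ℤ) else 0

/-! ## §2 Generating polynomials -/

/-- The letter variables `x_{ℓ,r}` (label `ℓ`, letter `r`). [folklore] -/
abbrev BlockRing : Type := MvPolynomial (Fin 3 × Fin 3) ℤ

/-- Generating polynomial of a triple column with labels `L`:
`Σ_σ sign σ · ∏_r x_{L r, σ r}`. [folklore] -/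
def tripleGen (L : Equiv.Perm (Fin 3)) : BlockRing :=
  ∑ σ : Equiv.Perm (Fin 3), ((Equiv.Perm.sign σ : ℤ) : BlockRing) * ∏ r : Fin 3, X (L r, σ r)

/-- Generating polynomial of a pair column with labels `P`:
`Σ_τ sign τ · ∏_r x_{P r, τ r}` (letters `A' = 0`, `A = 1`). [folklore] -/
def pairGen (P : Fin 2 → Fin 3) : BlockRing :=
  ∑ τ : Equiv.Perm (Fin 2), ((Equiv.Perm.sign τ : ℤ) : BlockRing) *
    ∏ r : Fin 2, X (P r, Fin.castSucc (τ r))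

/-- The generating polynomial of the whole design. [folklore] -/
def blockGen (k : ℕ) : BlockRing :=
  (∏ i : Fin (3 * k), tripleGen (dstarTripleLab k i)) * ∏ i : Fin (3 * k), pairGen (dstarPairLab k i)

/-- The matrix of letter variables `(x_{ℓ,r})_{ℓ,r}`. [folklore] -/
def xMat : Matrix (Fin 3) (Fin 3) BlockRing := Matrix.of fun ℓ r => X (ℓ, r)

/-- The `2 × 2` minors on the letters `A', A`: `Δ_{pq} = x_{p,0} x_{q,1} - x_{p,1} x_{q,0}`. [folklore] -/
def delta (p q : Fin 3) : BlockRing := X (p, 0) * X (q, 1) - X (p, 1) * X (q, 0)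

/-- A triple column generates `sign L · det (x_{ℓ,r})`. [folklore] -/
theorem tripleGen_eq (L : Equiv.Perm (Fin 3)) :
    tripleGen L = ((Equiv.Perm.sign L : ℤ) : BlockRing) * xMat.det := by
  have h1 : tripleGen L = (xMat.submatrix L id).transpose.det := by
    rw [Matrix.det_apply, tripleGen]
    refine Finset.sum_congr rfl fun σ _ => ?_
    rw [Units.smul_def, zsmul_eq_mul]
    rfl
  rw [h1, Matrix.det_transpose, Matrix.det_permute]

/-- A pair column generates the minor `x_{P0,0} x_{P1,1} - x_{P0,1} x_{P1,0}`. [folklore] -/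
theorem pairGen_eq (P : Fin 2 → Fin 3) :
    pairGen P = X (P 0, 0) * X (P 1, 1) - X (P 0, 1) * X (P 1, 0) := by
  rw [pairGen, show (Finset.univ : Finset (Equiv.Perm (Fin 2))) = {1, Equiv.swap 0 1} from by decide,
    Finset.sum_pair (by decide)]
  simp only [Equiv.Perm.sign_one, Units.val_one, Int.cast_one, one_mul, Fin.prod_univ_two,
    Equiv.Perm.one_apply, Equiv.Perm.sign_swap (show (0 : Fin 2) ≠ 1 by decide), Units.val_neg,
    Int.cast_neg, Equiv.swap_apply_left, Equiv.swap_apply_right]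
  have h0 : Fin.castSucc (0 : Fin 2) = (0 : Fin 3) := rfl
  have h1 : Fin.castSucc (1 : Fin 2) = (1 : Fin 3) := rfl
  rw [h0, h1]
  ring

/-- `det (x_{ℓ,r})` expanded along the `B` column: `x_{0,2} Δ₁₂ - x_{1,2} Δ₀₂ + x_{2,2} Δ₀₁`. [folklore] -/
theorem det_xMat_eq : xMat.det = X (0, 2) * delta 1 2 - X (1, 2) * delta 0 2 + X (2, 2) * delta 0 1 := by
  rw [Matrix.det_fin_three]
  simp only [xMat, Matrix.of_apply, delta]
  ring

/-- The triple columns of `D*` generate `det^{3k}` (the three label patterns have signs `+, -, +`,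
`k` columns each). [folklore] -/
theorem prod_tripleGen_eq (k : ℕ) :
    ∏ i : Fin (3 * k), tripleGen (dstarTripleLab k i) = (-1) ^ k * xMat.det ^ (3 * k) := by
  have h : ∀ i : Fin (3 * k), tripleGen (dstarTripleLab k i) =
      (if i.val < k then 1 else if i.val < 2 * k then -1 else 1) * xMat.det := by
    intro i
    rw [tripleGen_eq, dstarTripleLab]
    split_ifs with h1 h2
    · have : Equiv.Perm.sign (finRotate 3) = 1 := by decide
      rw [this]; simp
    · rw [Equiv.Perm.sign_swap (by decide)]; simp
    · simp
  rw [Finset.prod_congr rfl fun i _ => h i, Finset.prod_mul_distrib, Finset.prod_const,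
    Finset.card_univ, Fintype.card_fin]
  congr 1
  -- the sign product: `k` factors `-1`
  have e : (∏ x : Fin (3 * k), (if (x : ℕ) < k then (1 : BlockRing) else if (x : ℕ) < 2 * k then -1 else 1))
      = ∏ i ∈ Finset.range (3 * k), (if i < k then (1 : BlockRing) else if i < 2 * k then -1 else 1) :=
    Fin.prod_univ_eq_prod_range (fun i => if i < k then (1 : BlockRing) else if i < 2 * k then -1 else 1)
      (3 * k)
  rw [e, show 3 * k = k + (k + k) by ring, Finset.prod_range_add, Finset.prod_range_add]
  have h1 : ∏ x ∈ Finset.range k, (if x < k then (1 : BlockRing) else if x < 2 * k then -1 else 1) = 1 :=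
    Finset.prod_eq_one fun x hx => by
      rw [Finset.mem_range] at hx
      rw [if_pos hx]
  have h2 : ∏ x ∈ Finset.range k,
      (if k + x < k then (1 : BlockRing) else if k + x < 2 * k then -1 else 1) = (-1) ^ k := by
    rw [Finset.prod_congr rfl (g := fun _ => (-1 : BlockRing)), Finset.prod_const, Finset.card_range]
    intro x hx
    rw [Finset.mem_range] at hx
    rw [if_neg (by omega), if_pos (by omega)]
  have h3 : ∏ x ∈ Finset.range k,
      (if k + (k + x) < k then (1 : BlockRing) else if k + (k + x) < 2 * k then -1 else 1) = 1 :=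
    Finset.prod_eq_one fun x hx => by
      rw [if_neg (by omega), if_neg (by omega)]
  rw [h1, h2, h3]
  ring

/-- The pair columns of `D*` generate `(-1)^{3k} (Δ₀₁ Δ₀₂ Δ₁₂)^k`. [folklore] -/
theorem prod_pairGen_eq (k : ℕ) :
    ∏ i : Fin (3 * k), pairGen (dstarPairLab k i) =
      (-1) ^ (3 * k) * (delta 0 1 * delta 0 2 * delta 1 2) ^ k := by
  have h : ∀ i : Fin (3 * k), pairGen (dstarPairLab k i) =
      (-1) * (if i.val < k then delta 0 1 else if i.val < 2 * k then delta 0 2 else delta 1 2) := by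
    intro i
    rw [pairGen_eq, dstarPairLab]
    split_ifs <;> simp [delta] <;> ring
  rw [Finset.prod_congr rfl fun i _ => h i, Finset.prod_mul_distrib, Finset.prod_const,
    Finset.card_univ, Fintype.card_fin]
  congr 1
  have e : (∏ x : Fin (3 * k),
      (if (x : ℕ) < k then delta 0 1 else if (x : ℕ) < 2 * k then delta 0 2 else delta 1 2))
      = ∏ i ∈ Finset.range (3 * k),
        (if i < k then delta 0 1 else if i < 2 * k then delta 0 2 else delta 1 2) :=
    Fin.prod_univ_eq_prod_range
      (fun i => if i < k then delta 0 1 else if i < 2 * k then delta 0 2 else delta 1 2) (3 * k)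
  rw [e, show 3 * k = k + (k + k) by ring, Finset.prod_range_add, Finset.prod_range_add]
  have h1 : ∏ x ∈ Finset.range k,
      (if x < k then delta 0 1 else if x < 2 * k then delta 0 2 else delta 1 2) = delta 0 1 ^ k := by
    rw [Finset.prod_congr rfl (g := fun _ => delta 0 1), Finset.prod_const, Finset.card_range]
    intro x hx
    rw [Finset.mem_range] at hx
    rw [if_pos hx]
  have h2 : ∏ x ∈ Finset.range k,
      (if k + x < k then delta 0 1 else if k + x < 2 * k then delta 0 2 else delta 1 2) =
        delta 0 2 ^ k := by
    rw [Finset.prod_congr rfl (g := fun _ => delta 0 2), Finset.prod_const, Finset.card_range]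
    intro x hx
    rw [Finset.mem_range] at hx
    rw [if_neg (by omega), if_pos (by omega)]
  have h3 : ∏ x ∈ Finset.range k,
      (if k + (k + x) < k then delta 0 1 else if k + (k + x) < 2 * k then delta 0 2 else delta 1 2) =
        delta 1 2 ^ k := by
    rw [Finset.prod_congr rfl (g := fun _ => delta 1 2), Finset.prod_const, Finset.card_range]
    intro x hx
    rw [if_neg (by omega), if_neg (by omega)]
  rw [h1, h2, h3]
  ring

/-- **The generating polynomial of `D*` is `det^{3k} (Δ₀₁ Δ₀₂ Δ₁₂)^k`.** [folklore] -/
theorem blockGen_eq (k : ℕ) :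
    blockGen k = xMat.det ^ (3 * k) * (delta 0 1 * delta 0 2 * delta 1 2) ^ k := by
  rw [blockGen, prod_tripleGen_eq, prod_pairGen_eq]
  have : ((-1 : BlockRing)) ^ k * (-1) ^ (3 * k) = 1 := by
    rw [← pow_add, show k + 3 * k = 2 * (2 * k) by ring, pow_mul]; simp
  calc (-1) ^ k * xMat.det ^ (3 * k) * ((-1) ^ (3 * k) * (delta 0 1 * delta 0 2 * delta 1 2) ^ k)
      = ((-1 : BlockRing) ^ k * (-1) ^ (3 * k)) *
          (xMat.det ^ (3 * k) * (delta 0 1 * delta 0 2 * delta 1 2) ^ k) := by ring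
    _ = _ := by rw [this, one_mul]

/-! ## §3 The generating identity: `blockSum` is a coefficient of `blockGen` -/

/-- A triple column's generating polynomial as a signed sum of monomials. [folklore] -/
theorem tripleGen_eq_sum_monomial (L : Equiv.Perm (Fin 3)) :
    tripleGen L = ∑ σ : Equiv.Perm (Fin 3),
      C (Equiv.Perm.sign σ : ℤ) * monomial (∑ r : Fin 3, Finsupp.single (L r, σ r) 1) 1 := by
  unfold tripleGen
  refine Finset.sum_congr rfl fun σ _ => ?_
  rw [monomial_sum_one, (eq_intCast C _)]
  rfl

/-- A pair column's generating polynomial as a signed sum of monomials. [folklore] -/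
theorem pairGen_eq_sum_monomial (P : Fin 2 → Fin 3) :
    pairGen P = ∑ τ : Equiv.Perm (Fin 2),
      C (Equiv.Perm.sign τ : ℤ) *
        monomial (∑ r : Fin 2, Finsupp.single (P r, Fin.castSucc (τ r)) 1) 1 := by
  unfold pairGen
  refine Finset.sum_congr rfl fun τ _ => ?_
  rw [monomial_sum_one, (eq_intCast C _)]
  rfl

/-- **The generating polynomial of `D*` as a signed sum of configuration monomials.** [folklore] -/
theorem blockGen_eq_sum (k : ℕ) :
    blockGen k = ∑ σ : Fin (3 * k) → Equiv.Perm (Fin 3), ∑ τ : Fin (3 * k) → Equiv.Perm (Fin 2),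
      C ((∏ i, (Equiv.Perm.sign (σ i) : ℤ)) * ∏ i, (Equiv.Perm.sign (τ i) : ℤ)) *
        monomial (blockExpo k σ τ) 1 := by
  unfold blockGen
  simp_rw [tripleGen_eq_sum_monomial, pairGen_eq_sum_monomial]
  rw [Fintype.prod_sum, Fintype.prod_sum, Finset.sum_mul]
  refine Finset.sum_congr rfl fun σ _ => ?_
  rw [Finset.mul_sum]
  refine Finset.sum_congr rfl fun τ _ => ?_
  rw [Finset.prod_mul_distrib, Finset.prod_mul_distrib, ← map_prod C, ← map_prod C,
    ← monomial_sum_one, ← monomial_sum_one, map_mul, blockExpo]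
  rw [show ∀ (e f : (Fin 3 × Fin 3) →₀ ℕ), monomial (e + f) (1 : ℤ) = monomial e 1 * monomial f 1 from
      fun e f => by rw [monomial_mul, mul_one]]
  ring

/-- **`blockSum k` is the coefficient of the target exponent in the generating polynomial.**
[folklore] -/
theorem coeff_blockGen (k : ℕ) : coeff (blockTgt k) (blockGen k) = blockSum k := by
  rw [blockGen_eq_sum, coeff_sum, blockSum]
  refine Finset.sum_congr rfl fun σ _ => ?_
  rw [coeff_sum]
  refine Finset.sum_congr rfl fun τ _ => ?_
  rw [coeff_C_mul, coeff_monomial]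
  split_ifs <;> simp

end

end Summit.ValiantsHypothesis.ValiantsHypothesis.Theorems.GeneratorObstructions.PowGenDegreeQP
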